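import Literature.Topology.FourManifolds.WallHandlebodySplice
import Literature.Topology.FourManifolds.RegularSublevelMorseLocal
import Literature.Topology.FourManifolds.MilnorChartIndex
import HarnessLib

/-!
# Wall 1964, Lemma 2, Morse-theoretic route: the handlebody `H = D⁵ ∪ {g ≤ m}` and its
# boundary

Topic `Literature/Topology/FourManifolds` (fact seat
`provefact-Literature.Topology.FourManifolds.exists-68ee520c9a`, Wall 1964, Lemma 2,
`WallBoundingHandlebody.lean`; item 6 of the route recorded there).  Everything here is
**proved**; no named facts.

With the spliced Morse function `Ψ` on `W` of `WallHandlebodySplice.lean` (it is `f` near the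
bottom ball, `a₀ + (b₀ − a₀) · (3/δ) g` on the relevant part of the slab `K`, constant near
`M`), the sublevel set `H = {Ψ ≤ μ} = D⁵ ∪ {g ≤ m}` is a compact smooth manifold with
boundary `{Ψ = μ} = g⁻¹(m)` (Milnor 1965, Lemma 2.9 in the local form
`sublevel_morseData_local`), and `Ψ|_H` is a Morse function adapted to `∂H` whose critical
points are the minimum `p₀` (index `0`) and the critical points of `g` below `m`, with the
indices of `g` (`NullCobordism.BottomSlab.Splice.exists_handlebody`).  So `H` has a handle
decomposition with one 0-handle and, for each `j`, as many `j`-handles as `g` has critical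
points of index `j` below `m` — in the application (`WallHandlebodyProgram.lean`) `k`
2-handles and nothing else: Wall's `H = D⁵ ∪ ⋃ (D² × D³)`.  Moreover `∂H` is diffeomorphic to
the incoming end `g⁻¹(m)` of the slab cobordism `g⁻¹[m, b₁]` (both are smoothly embedded in
`K` onto the level, Lee 2013, Cor. 5.30).

## References

* C. T. C. Wall, *On simply-connected 4-manifolds*, J. London Math. Soc. 39 (1964), Lemma 2
  and its proof (pp. 143–144). [WallJLMS1964]
* J. Milnor, *Lectures on the h-cobordism theorem* (1965), Lemma 2.9, Def. 3.1, §3. [MilnorHCobordism1965]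
* J. M. Lee, *Introduction to Smooth Manifolds*, 2nd ed. (2013), Thm. 5.11, Cor. 5.30. [LeeSmoothManifolds2013]
-/

open scoped Manifold ContDiff Topology
open Set Function Filter

noncomputable section

universe u

namespace Literature.Topology.FourManifolds

/-- Local notation: `𝔼 n` is the model Euclidean space `EuclideanSpace ℝ (Fin n)`. -/
local notation "𝔼 " n:arg => EuclideanSpace ℝ (Fin n)
/-- Local notation: `ℍ n` is the model half-space `EuclideanHalfSpace n`. -/
local notation "ℍ " n:arg => EuclideanHalfSpace n

namespace NullCobordism

variable {n : ℕ} {M : Type u} [TopologicalSpace M] [ChartedSpace (𝔼 n) M]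

/-! ### The minimum `p₀` has index `0` -/

/-- **The bottom critical point has Morse index `0`** (the Morse chart of the ball data is a
Milnor chart `f = f(p₀) + ‖x‖² = f(p₀) + Q₀(x)`, Milnor 1965, Def. 3.1; the tree's
`isMCriticalPt_and_morseIndex_eq_of_eq_milnorQuadratic`). [cite: MilnorHCobordism1965, Def. 3.1 and Thm. 2.5] -/
theorem BottomBall.morseIndex_p₀ [T2Space M] [SecondCountableTopology M] [IsManifold (𝓡 n) ∞ M]
    [CompactSpace M] {c : NullCobordism n M} (B : c.BottomBall) :
    morseIndex (𝓡∂ (n + 1)) B.f B.p₀ = 0 := by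
  have hf : ContMDiffAt (𝓡∂ (n + 1)) 𝓘(ℝ, ℝ) 2 B.f B.p₀ :=
    (B.isMorseFunction.isMorse.contMDiff.of_le (by norm_cast)).contMDiffAt
  have h := isMCriticalPt_and_morseIndex_eq_of_eq_milnorQuadratic (k := 0) hf B.mem_maximalAtlas
    B.mem_source B.isInteriorPoint (fun q hq => by rw [milnorQuadratic_zero_left]; exact B.apply_eq q hq)
  rw [h.2, Nat.min_zero]

namespace BottomSlab

variable {c : NullCobordism n M} {S : c.BottomSlab}

namespace Splice

variable {g : S.K → ℝ} {m : ℝ} (D : S.Splice g m)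

/-! ### The critical points of `Ψ` in `{Ψ ≤ μ}` -/

/-- **Near `p₀`, and more generally below `a⋆`, `Ψ = f`.** [folklore] -/
theorem Ψ_eventuallyEq_f [T2Space M] [SecondCountableTopology M] [IsManifold (𝓡 n) ∞ M]
    [CompactSpace M] (hn : 1 ≤ n) {a₁ : ℝ} (ha₁b : a₁ ≤ S.b₀)
    (ha₁ : ∀ p : S.K, S.f (RegularSlab.incl S.isRegularSlab p) < a₁ → g p < D.δ / 3) {z : c.W}
    (hz : S.f z < a₁) : D.Ψ =ᶠ[𝓝 z] S.f := by
  have ho : IsOpen {w : c.W | S.f w < a₁} :=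
    isOpen_lt S.isMorseFunction.isMorse.contMDiff.continuous continuous_const
  filter_upwards [ho.mem_nhds hz] with w hw
  exact D.Ψ_eq_f_of_lt_aStar hn ha₁b ha₁ hw

/-- `p₀` is a critical point of `Ψ`, of index `0`, with nondegenerate Hessian, and `Ψ p₀ < μ`.
[cite: MilnorHCobordism1965, Def. 3.1] -/
theorem critical_p₀ [T2Space M] [SecondCountableTopology M] [IsManifold (𝓡 n) ∞ M] [CompactSpace M]
    (hn : 1 ≤ n) (hg : S.cobordism.IsMorseFunction g) :
    IsMCriticalPt (𝓡∂ (n + 1)) D.Ψ S.p₀ ∧ morseIndex (𝓡∂ (n + 1)) D.Ψ S.p₀ = 0 ∧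
      (mhessian (𝓡∂ (n + 1)) D.Ψ S.p₀).Nondegenerate ∧ D.Ψ S.p₀ < D.μ := by
  obtain ⟨a₁, ha₀, ha₁b, ha₁⟩ := D.exists_aStar hn hg
  have hp₀ : S.f S.p₀ < a₁ := S.apply_p₀_lt_botLevel.trans ha₀
  have hev := D.Ψ_eventuallyEq_f hn ha₁b ha₁ hp₀
  refine ⟨(isMCriticalPt_congr_of_eventuallyEq hev).2 S.isMCriticalPt, ?_, ?_, ?_⟩
  · rw [morseIndex_congr_of_eventuallyEq hev]; exact S.toBottomBall.morseIndex_p₀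
  · rw [mhessian_congr_of_eventuallyEq_add_const (I := 𝓡∂ (n + 1)) (c := 0)
      (hev.trans (Filter.Eventually.of_forall fun q => (add_zero _).symm))]
    exact S.isMorseFunction.isMorse.nondegenerate S.isMCriticalPt
  · rw [D.Ψ_of_lt S.apply_p₀_lt_botLevel]
    exact S.apply_p₀_lt_botLevel.trans D.botLevel_lt_μ

/-- A point with `Ψ ≤ μ` not below `a⋆` is a slab point with `g ≤ m`. [folklore] -/
theorem mem_slab_of_Ψ_le [T2Space M] [SecondCountableTopology M] [IsManifold (𝓡 n) ∞ M]
    [CompactSpace M] (hn : 1 ≤ n) (hg : S.cobordism.IsMorseFunction g) {z : c.W} (hz : D.Ψ z ≤ D.μ)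
    (hza : S.botLevel ≤ S.f z) :
    ∃ hmem : S.f z ∈ Icc S.botLevel S.b₀, g (RegularSlab.mk S.isRegularSlab z hmem) ≤ m := by
  have hzb : S.f z ≤ S.b₀ := by
    by_contra h
    rw [D.Ψ_of_gt (not_le.1 h)] at hz
    linarith [D.μ_lt_const]
  exact ⟨⟨hza, hzb⟩, (D.Ψ_le_μ_iff_of_mem hn hg ⟨hza, hzb⟩).1 hz⟩

/-- **The critical points of `Ψ` in `{Ψ ≤ μ}`**: the minimum `p₀`, and the critical points of
`g` below `m` (below `a⋆`, `Ψ = f` whose only critical point not above `a₀` is `p₀`, the slab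
points there having `g < δ/3` and so being regular for `fn`; elsewhere in `{Ψ ≤ μ}` one is on
the slab with `g ≤ m`, where `Ψ` and `g` have the same critical points).
[cite: WallJLMS1964, proof of Lemma 2 (p. 144)] [cite: MilnorHCobordism1965, Lemma 2.9] -/
theorem isMCriticalPt_Ψ_iff_of_le [T2Space M] [SecondCountableTopology M] [IsManifold (𝓡 n) ∞ M]
    [CompactSpace M] (hn : 1 ≤ n) (hg : S.cobordism.IsMorseFunction g)
    (hregm : ∀ p ∈ criticalSet (𝓡∂ (n + 1)) g, g p ≠ m) {z : c.W} (hz : D.Ψ z ≤ D.μ) :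
    IsMCriticalPt (𝓡∂ (n + 1)) D.Ψ z ↔
      z = S.p₀ ∨ ∃ p : S.K, RegularSlab.incl S.isRegularSlab p = z ∧
        p ∈ criticalSet (𝓡∂ (n + 1)) g ∧ g p < m := by
  obtain ⟨a₁, ha₀, ha₁b, ha₁⟩ := D.exists_aStar hn hg
  by_cases hlt : S.f z < a₁
  · have hev := D.Ψ_eventuallyEq_f hn ha₁b ha₁ hlt
    rw [isMCriticalPt_congr_of_eventuallyEq hev]
    constructor
    · intro hc
      by_cases hzp : z = S.p₀
      · exact Or.inl hzp
      · exfalso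
        have hza : S.botLevel < S.f z := S.botLevel_lt_apply hc hzp
        have hmem : S.f z ∈ Icc S.botLevel S.b₀ := ⟨hza.le, hlt.le.trans ha₁b⟩
        set p := RegularSlab.mk S.isRegularSlab z hmem with hp
        have hgp : g p < D.δ / 3 := ha₁ p hlt
        have hcfn : IsMCriticalPt (𝓡∂ (n + 1)) (RegularSlab.fn S.isRegularSlab) p :=
          (RegularSlab.isMCriticalPt_fn_iff S.isRegularSlab hn p).2 hc
        have := D.δ_lt_of_mem_fn p hcfn
        linarith [D.δ_pos]
    · rintro (rfl | ⟨p, rfl, hpc, hpm⟩)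
      · exact S.isMCriticalPt
      · exfalso
        have h1 := ha₁ p hlt
        have h2 := D.δ_lt_of_mem p hpc
        linarith [D.δ_pos]
  · have hza : S.botLevel ≤ S.f z := ha₀.le.trans (not_lt.1 hlt)
    obtain ⟨hmem, hgm⟩ := D.mem_slab_of_Ψ_le hn hg hz hza
    set p := RegularSlab.mk S.isRegularSlab z hmem with hp
    have hzp : RegularSlab.incl S.isRegularSlab p = z := rfl
    have key : IsMCriticalPt (𝓡∂ (n + 1)) D.Ψ z ↔ p ∈ criticalSet (𝓡∂ (n + 1)) g :=
      D.isMCriticalPt_Ψ_incl_iff_of_le hn hg hgm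
    rw [key]
    constructor
    · intro hc
      exact Or.inr ⟨p, hzp, hc, lt_of_le_of_ne hgm (hregm p hc)⟩
    · rintro (hz0 | ⟨p', hp', hpc, -⟩)
      · exfalso
        rw [hz0] at hza
        linarith [S.apply_p₀_lt_botLevel]
      · have : p' = p := by
          apply RegularSlab.injective_incl S.isRegularSlab
          rw [hp', hzp]
        rw [← this]; exact hpc

/-- **The Hessian of `Ψ` is nondegenerate at every critical point of `{Ψ ≤ μ}`.**
[cite: MilnorHCobordism1965, Lemma 2.9 and Thm. 4.8] -/
theorem nondegenerate_of_le [T2Space M] [SecondCountableTopology M] [IsManifold (𝓡 n) ∞ M]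
    [CompactSpace M] (hn : 1 ≤ n) (hg : S.cobordism.IsMorseFunction g)
    (hregm : ∀ p ∈ criticalSet (𝓡∂ (n + 1)) g, g p ≠ m) {z : c.W} (hz : D.Ψ z ≤ D.μ)
    (hc : IsMCriticalPt (𝓡∂ (n + 1)) D.Ψ z) : (mhessian (𝓡∂ (n + 1)) D.Ψ z).Nondegenerate := by
  rcases (D.isMCriticalPt_Ψ_iff_of_le hn hg hregm hz).1 hc with rfl | ⟨p, rfl, hpc, hpm⟩
  · exact (D.critical_p₀ hn hg).2.2.1
  · exact D.nondegenerate_Ψ_incl hn hg hpm.le hpc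

/-- **The critical points of `Ψ` of index `j` in `{Ψ ≤ μ}`**: `{p₀}` for `j = 0` together with
the image of the critical points of `g` of index `j` below `m`. [cite: WallJLMS1964, proof of Lemma 2 (p. 144)] -/
theorem criticalSetOfIndex_inter_eq [T2Space M] [SecondCountableTopology M] [IsManifold (𝓡 n) ∞ M]
    [CompactSpace M] (hn : 1 ≤ n) (hg : S.cobordism.IsMorseFunction g)
    (hregm : ∀ p ∈ criticalSet (𝓡∂ (n + 1)) g, g p ≠ m) (j : ℕ) :
    criticalSetOfIndex (𝓡∂ (n + 1)) D.Ψ j ∩ D.Ψ ⁻¹' Iic D.μ =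
      (if j = 0 then ({S.p₀} : Set c.W) else (∅ : Set c.W)) ∪
        (fun p : S.K => (RegularSlab.incl S.isRegularSlab p : c.W)) ''
          (criticalSetOfIndex (𝓡∂ (n + 1)) g j ∩ g ⁻¹' Iio m) := by
  have hp₀ := D.critical_p₀ hn hg
  ext z
  simp only [mem_inter_iff, mem_preimage, mem_Iic, mem_union, mem_image, mem_Iio]
  constructor
  · rintro ⟨⟨hc, hidx⟩, hz⟩
    rcases (D.isMCriticalPt_Ψ_iff_of_le hn hg hregm hz).1 hc with rfl | ⟨p, rfl, hpc, hpm⟩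
    · left
      have hj : j = 0 := by rw [← hidx, hp₀.2.1]
      subst hj
      rw [if_pos rfl]
      exact mem_singleton _
    · right
      refine ⟨p, ⟨⟨hpc, ?_⟩, hpm⟩, rfl⟩
      rw [← hidx, D.morseIndex_Ψ_incl_eq hn hg hpm.le hpc]
  · rintro (h | ⟨p, ⟨⟨hpc, hidx⟩, hpm⟩, rfl⟩)
    · by_cases hj : j = 0
      · subst hj
        rw [if_pos rfl, mem_singleton_iff] at h
        subst h
        exact ⟨⟨hp₀.1, hp₀.2.1⟩, hp₀.2.2.2.le⟩
      · rw [if_neg hj] at h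
        exact absurd h (notMem_empty z)
    · have hle : D.Ψ (RegularSlab.incl S.isRegularSlab p) ≤ D.μ :=
        (D.Ψ_le_μ_iff_of_mem hn hg p.2).2 hpm.le
      refine ⟨⟨(D.isMCriticalPt_Ψ_incl_iff_of_le hn hg hpm.le).2 hpc, ?_⟩, hle⟩
      rw [D.morseIndex_Ψ_incl_eq hn hg hpm.le hpc, hidx]

/-- **Counting**: the number of critical points of `Ψ` of index `j` in `{Ψ ≤ μ}` is
`[j = 0] + #{critical points of g of index j below m}`. [cite: WallJLMS1964, proof of Lemma 2 (p. 144)] -/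
theorem ncard_criticalSetOfIndex_inter [T2Space M] [SecondCountableTopology M] [IsManifold (𝓡 n) ∞ M]
    [CompactSpace M] (hn : 1 ≤ n) (hg : S.cobordism.IsMorseFunction g)
    (hregm : ∀ p ∈ criticalSet (𝓡∂ (n + 1)) g, g p ≠ m) (j : ℕ) :
    (criticalSetOfIndex (𝓡∂ (n + 1)) D.Ψ j ∩ D.Ψ ⁻¹' Iic D.μ).ncard =
      (if j = 0 then 1 else 0) + (criticalSetOfIndex (𝓡∂ (n + 1)) g j ∩ g ⁻¹' Iio m).ncard := by
  classical
  rw [D.criticalSetOfIndex_inter_eq hn hg hregm j]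
  set A : Set c.W := if j = 0 then ({S.p₀} : Set c.W) else (∅ : Set c.W) with hA
  set B : Set c.W := (fun p : S.K => (RegularSlab.incl S.isRegularSlab p : c.W)) ''
    (criticalSetOfIndex (𝓡∂ (n + 1)) g j ∩ g ⁻¹' Iio m) with hB
  have hfin : (criticalSetOfIndex (𝓡∂ (n + 1)) g j ∩ g ⁻¹' Iio m).Finite :=
    hg.finite_criticalSet.subset fun p hp => hp.1.1
  have hAfin : A.Finite := by rw [hA]; split_ifs <;> simp
  have hBfin : B.Finite := hfin.image _
  have hdisj : Disjoint A B := by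
    refine Set.disjoint_left.2 ?_
    rintro z hz ⟨p, -, rfl⟩
    have h1 : (RegularSlab.incl S.isRegularSlab p : c.W) = S.p₀ := by
      by_cases hj : j = 0
      · rw [hA, if_pos hj, mem_singleton_iff] at hz; exact hz
      · rw [hA, if_neg hj] at hz; exact absurd hz (notMem_empty _)
    have h2 : S.botLevel ≤ S.f (RegularSlab.incl S.isRegularSlab p) := p.2.1
    rw [h1] at h2
    linarith [S.apply_p₀_lt_botLevel]
  have hAcard : A.ncard = if j = 0 then 1 else 0 := by
    rw [hA]; split_ifs <;> simp
  have hBcard : B.ncard = (criticalSetOfIndex (𝓡∂ (n + 1)) g j ∩ g ⁻¹' Iio m).ncard :=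
    ncard_image_of_injective _ (fun p q hpq => RegularSlab.injective_incl S.isRegularSlab hpq)
  rw [ncard_union_eq hdisj hAfin hBfin, hAcard, hBcard]

/-! ### The handlebody -/

/-- The slab point of a point of the level `{Ψ = μ}`. [folklore] -/
theorem mem_Icc_of_Ψ_eq_μ [T2Space M] [SecondCountableTopology M] [IsManifold (𝓡 n) ∞ M]
    [CompactSpace M] (hn : 1 ≤ n) (hg : S.cobordism.IsMorseFunction g) {z : c.W} (hz : D.Ψ z = D.μ) :
    S.f z ∈ Icc S.botLevel S.b₀ :=
  ((D.Ψ_eq_μ_iff hn hg z).1 hz).fst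

/-- A point of the level `{Ψ = μ}` lies on the level `g = m` of the slab. [folklore] -/
theorem apply_mk_eq_of_Ψ_eq_μ [T2Space M] [SecondCountableTopology M] [IsManifold (𝓡 n) ∞ M]
    [CompactSpace M] (hn : 1 ≤ n) (hg : S.cobordism.IsMorseFunction g) {z : c.W} (hz : D.Ψ z = D.μ) :
    g (RegularSlab.mk S.isRegularSlab z (D.mem_Icc_of_Ψ_eq_μ hn hg hz)) = m :=
  ((D.Ψ_eq_μ_iff hn hg z).1 hz).snd

/-- A point of the level `g = m` of the slab has `Ψ = μ`. [folklore] -/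
theorem Ψ_incl_eq_μ [T2Space M] [SecondCountableTopology M] [IsManifold (𝓡 n) ∞ M]
    [CompactSpace M] (hn : 1 ≤ n) (hg : S.cobordism.IsMorseFunction g) {p : S.K} (hp : g p = m) :
    D.Ψ (RegularSlab.incl S.isRegularSlab p) = D.μ := by
  rw [D.Ψ_incl, D.ψ_eq_μ_iff hn hg]; exact hp

include D in
/-- **Wall 1964, Lemma 2: the handlebody `H = D⁵ ∪ {g ≤ m}` and its boundary** (the module
docstring displays the argument).  For the bottom slab `K` of the null-cobordism `W` of `M`, a
Morse function `g` of the triad on `K`, a non-critical level `m ∈ (0, 1)` of `g` and a regular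
slab `g⁻¹[m, b₁]`: the sublevel set `H = {Ψ ≤ μ}` of the spliced function is a compact smooth
`(n + 1)`-manifold with boundary carrying a handle decomposition with one 0-handle and, for each
`j`, as many `j`-handles as `g` has critical points of index `j` below `m`; and `∂H` is
diffeomorphic to the incoming end `g⁻¹(m)` of the slab cobordism `g⁻¹[m, b₁]`.
[cite: WallJLMS1964, Lemma 2 and its proof (pp. 143–144)] [cite: MilnorHCobordism1965, Lemma 2.9, Def. 3.1, §3] [cite: LeeSmoothManifolds2013, Thm. 5.11, Cor. 5.30] -/
theorem exists_handlebody [T2Space M] [SecondCountableTopology M] [IsManifold (𝓡 n) ∞ M]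
    [CompactSpace M] (hn : 1 ≤ n) (hg : S.cobordism.IsMorseFunction g)
    (hregm : ∀ p ∈ criticalSet (𝓡∂ (n + 1)) g, g p ≠ m) {b₁ : ℝ}
    (h₁ : S.cobordism.IsRegularSlab g m b₁) :
    ∃ (H : Type u) (_ : TopologicalSpace H) (_ : T2Space H) (_ : SecondCountableTopology H)
      (_ : ChartedSpace (ℍ (n + 1)) H) (_ : IsManifold (𝓡∂ (n + 1)) ∞ H) (_ : CompactSpace H),
      HasHandleDecomposition n H (fun j =>
        (if j = 0 then 1 else 0) + (criticalSetOfIndex (𝓡∂ (n + 1)) g j ∩ g ⁻¹' Iio m).ncard) ∧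
      Nonempty (((𝓡∂ (n + 1)).boundary H) ≃ₘ⟮𝓡 n, 𝓡 n⟯ RegularSlab.botEnd h₁) := by
  haveI : NeZero n := ⟨by omega⟩
  have hΨs := D.contMDiff_Ψ hn hg
  have hint : ∀ z, D.Ψ z ≤ D.μ → (𝓡∂ (n + 1)).IsInteriorPoint z := fun z hz =>
    D.isInteriorPoint_of_Ψ_le hz
  have hreg : ∀ z, IsMCriticalPt (𝓡∂ (n + 1)) D.Ψ z → D.Ψ z ≠ D.μ := fun z hz =>
    D.Ψ_ne_μ_of_isMCriticalPt hn hg hregm hz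
  have hnondeg : ∀ z, D.Ψ z ≤ D.μ → IsMCriticalPt (𝓡∂ (n + 1)) D.Ψ z →
      (mhessian (𝓡∂ (n + 1)) D.Ψ z).Nondegenerate := fun z hz hc =>
    D.nondegenerate_of_le hn hg hregm hz hc
  obtain ⟨hreg', hM, hemb, hMorse, hcrit, hidx, hbd⟩ :=
    sublevel_morseData_local (k := n) hn hΨs hint hreg hnondeg
  letI instCS : ChartedSpace (ℍ (n + 1)) ↥(D.Ψ ⁻¹' Iic D.μ) :=
    (sublevelAtlas hΨs D.μ hint hreg').chartedSpace
  haveI : IsManifold (𝓡∂ (n + 1)) ∞ ↥(D.Ψ ⁻¹' Iic D.μ) := hM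
  haveI hcpt : CompactSpace ↥(D.Ψ ⁻¹' Iic D.μ) :=
    isCompact_iff_compactSpace.1 ((isClosed_le hΨs.continuous continuous_const).isCompact)
  refine ⟨↥(D.Ψ ⁻¹' Iic D.μ), inferInstance, inferInstance, inferInstance, instCS, hM, hcpt, ?_, ?_⟩
  · -- the handle decomposition: `Ψ|_H + (1 − μ)` and the count
    refine ⟨fun x => D.Ψ x.1 + (1 - D.μ), hMorse, fun j => ?_⟩
    have hset : Subtype.val '' criticalSetOfIndex (𝓡∂ (n + 1))
        (fun x : ↥(D.Ψ ⁻¹' Iic D.μ) => D.Ψ x.1 + (1 - D.μ)) j =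
        criticalSetOfIndex (𝓡∂ (n + 1)) D.Ψ j ∩ D.Ψ ⁻¹' Iic D.μ := by
      ext z
      constructor
      · rintro ⟨x, ⟨hxc, hxi⟩, rfl⟩
        have hc' := (hcrit x).1 hxc
        exact ⟨⟨hc', by rw [← hidx x hc']; exact hxi⟩, x.2⟩
      · rintro ⟨⟨hc, hi⟩, hz⟩
        refine ⟨⟨z, hz⟩, ⟨(hcrit ⟨z, hz⟩).2 hc, ?_⟩, rfl⟩
        rw [hidx ⟨z, hz⟩ hc]; exact hi
    rw [← ncard_image_of_injective _ Subtype.val_injective, hset]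
    exact D.ncard_criticalSetOfIndex_inter hn hg hregm j
  · -- the boundary is the level `g = m`
    set hL := RegularSlab.isRegularLevel_left h₁ with hLd
    -- the two maps
    have hx : ∀ x : (𝓡∂ (n + 1)).boundary ↥(D.Ψ ⁻¹' Iic D.μ), D.Ψ x.1.1 = D.μ := fun x => (hbd x.1).1 x.2
    have hle : ∀ z : RegularLevel hL, D.Ψ (RegularSlab.incl S.isRegularSlab z.1) ≤ D.μ := fun z =>
      (D.Ψ_incl_eq_μ hn hg z.2).le
    have hbd' : ∀ z : RegularLevel hL,
        (𝓡∂ (n + 1)).IsBoundaryPoint (⟨RegularSlab.incl S.isRegularSlab z.1, hle z⟩ : ↥(D.Ψ ⁻¹' Iic D.μ)) :=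
      fun z => (hbd _).2 (D.Ψ_incl_eq_μ hn hg z.2)
    -- smoothness of `x ↦ mk x` into `K`
    have hval2 : ContMDiff (𝓡 n) (𝓡∂ (n + 1)) ∞
        (fun x : (𝓡∂ (n + 1)).boundary ↥(D.Ψ ⁻¹' Iic D.μ) => (x.1.1 : c.W)) :=
      hemb.contMDiff.comp BoundaryManifold.isImmersion_subtype_val.contMDiff
    have htoK : ContMDiff (𝓡 n) (𝓡∂ (n + 1)) ∞
        (fun x : (𝓡∂ (n + 1)).boundary ↥(D.Ψ ⁻¹' Iic D.μ) =>
          RegularSlab.mk S.isRegularSlab (x.1.1 : c.W) (D.mem_Icc_of_Ψ_eq_μ hn hg (hx x))) :=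
      RegularSlab.contMDiff_codRestrict S.isRegularSlab hn hval2 _
    have htoW : ContMDiff (𝓡 n) (𝓡∂ (n + 1)) ∞
        (fun z : RegularLevel hL => (RegularSlab.incl S.isRegularSlab z.1 : c.W)) :=
      (RegularSlab.contMDiff_incl S.isRegularSlab hn).comp (RegularLevel.contMDiff_incl hL)
    have htoH : ContMDiff (𝓡 n) (𝓡∂ (n + 1)) ∞
        (fun z : RegularLevel hL => (⟨RegularSlab.incl S.isRegularSlab z.1, hle z⟩ : ↥(D.Ψ ⁻¹' Iic D.μ))) :=
      (ContMDiff.iff_comp_isImmersion ((sublevelAtlas hΨs D.μ hint hreg').isImmersion_subtype_val hn)).2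
        ⟨htoW.continuous.subtype_mk _, htoW⟩
    let e : ((𝓡∂ (n + 1)).boundary ↥(D.Ψ ⁻¹' Iic D.μ)) ≃ₘ⟮𝓡 n, 𝓡 n⟯ RegularLevel hL :=
      { toFun := fun x => ⟨RegularSlab.mk S.isRegularSlab (x.1.1 : c.W)
            (D.mem_Icc_of_Ψ_eq_μ hn hg (hx x)), D.apply_mk_eq_of_Ψ_eq_μ hn hg (hx x)⟩
        invFun := fun z => ⟨⟨RegularSlab.incl S.isRegularSlab z.1, hle z⟩, hbd' z⟩
        left_inv := fun x => rfl
        right_inv := fun z => rfl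
        contMDiff_toFun :=
          (ContMDiff.iff_comp_isImmersion (RegularLevel.isImmersion_incl hL)).2
            ⟨htoK.continuous.subtype_mk _, htoK⟩
        contMDiff_invFun :=
          (ContMDiff.iff_comp_isImmersion BoundaryManifold.isImmersion_subtype_val).2
            ⟨htoH.continuous.subtype_mk _, htoH⟩ }
    exact ⟨e.trans (RegularSlab.botEndDiffeomorph h₁)⟩

end Splice

end BottomSlab

end NullCobordism

end Literature.Topology.FourManifolds
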